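import Summits.QuantumFields.YangMills.Theorems.UnitScaleTiltFluctuationComparisonRegPrLiftLegsKernel

/-!
# Route `UnitScaleTilt` — crux K1bR-pr `FluctuationComparisonRegPr` (stmt-QuantumFields-19201 → `…L`), stub `stub_oneStepSmallLift`, piece (L2)
# for INTERIOR-SUPPORTED kernels — the Γ-LEG LAYER, file 8: THE COEFFICIENT FORM OF LINE-NEUTRALITY (finitely many scalar identities on the
# table imply `LineNeutral`; support file `--supports stmt-QuantumFields-19201`)

Cell `ym3-torus` (HUMAN RULING D-0037, YM ladder rung R3), seat `ym3-torus-p1` gen 11 (UV side; cell memo HOME/UV3-NODE.md §20).  `LineNeutral R kz`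
(`…LiftLegsKernel`) quantifies over all matrix fields `w`; a concrete table (rational certificate or symbolic closed form) is checked through
its COEFFICIENTS.  Grouping the line form by the displacement `m` at which `w` is read:

* `lineWindow d R` = the box `[−R, R+1]^d ⊇` all displacements read by the line form (`kvec_mem_lineWindow`, `bvec_add_kvec_mem_lineWindow`);
* **`lineCoeff R kz a o m`** `= Σ_r Σ_{t<L−r_a} Σ_{k : k−R = m} kz(a, r[a↦r_a+t], o, k) + Σ_r Σ_{t<r_a} Σ_{k : e_a+k−R = m} kz(a, r[a↦t], o, k)` (a real number);
* `lineIn_add_lineOut_eq`: `lineIn + lineOut = L^{-d} Σ_o Σ_{m ∈ lineWindow} lineCoeff(a,o,m) • w(o,m)`;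
* **`lineNeutral_of_lineCoeff`**: `(∀ a o, ∀ m ∈ lineWindow, lineCoeff R kz a o m = 0) → LineNeutral R kz` — a FINITE family of scalar identities,
  `decide`/`norm_num`-able for rational tables and provable symbolically for closed forms (for this lineage's dual Whitney lift it is
  `Sline ∘ Zop = 0`, p476131, read in tree coordinates).

Elementary; nothing of Bałaban's is asserted.
-/

noncomputable section

open scoped BigOperators

namespace Summit.QuantumFields.YangMills.Theorems.ApproxLift

open Literature.MathematicalPhysics.QuantumFieldTheory.Balaban1983to89
open T4Continuum BlockAveraging AveragingRT B10Eq47AxialChi BlockAveragingSection BlockAveragingSectionPlaq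

variable {P : Params} {j : ℕ} {n : Type*}
variable {R : ℕ} {kz : Fin P.d → (Fin P.d → Fin P.L) → Orient P.d → (Fin P.d → Fin (2 * R + 1)) → ℝ}

/-! ## §1 The window of displacements read by the line form -/

/-- The box `[−R, R+1]^d` of integer displacements. -/
def lineWindow (d R : ℕ) : Finset (Fin d → ℤ) := Fintype.piFinset fun _ => Finset.Icc (-(R : ℤ)) (R + 1)

/-- `k − R ∈ [−R, R+1]^d`. -/
theorem kvec_mem_lineWindow (R : ℕ) {d : ℕ} (k : Fin d → Fin (2 * R + 1)) : kvec R k ∈ lineWindow d R := by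
  rw [lineWindow, Fintype.mem_piFinset]
  intro i
  rw [Finset.mem_Icc]
  unfold kvec
  have := (k i).isLt
  constructor <;> omega

/-- `e_a + k − R ∈ [−R, R+1]^d`. -/
theorem bvec_add_kvec_mem_lineWindow (R : ℕ) {d : ℕ} (a : Fin d) (k : Fin d → Fin (2 * R + 1)) :
    bvec true a + kvec R k ∈ lineWindow d R := by
  rw [lineWindow, Fintype.mem_piFinset]
  intro i
  rw [Finset.mem_Icc, Pi.add_apply]
  unfold kvec bvec
  have := (k i).isLt
  constructor <;> split_ifs <;> omega

/-! ## §2 The coefficients of the line form -/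

/-- **THE LINE COEFFICIENT** of the table at direction `a`, orientation `o`, displacement `m`: the total weight with which the line form reads
`w(o, m)` — in-row entries with `k − R = m` plus far-row entries with `e_a + k − R = m`. -/
def lineCoeff (R : ℕ) (kz : Fin P.d → (Fin P.d → Fin P.L) → Orient P.d → (Fin P.d → Fin (2 * R + 1)) → ℝ) (a : Fin P.d)
    (o : Orient P.d) (m : Fin P.d → ℤ) : ℝ :=
  (∑ r : Fin P.d → Fin P.L, ∑ t : Fin (P.L - (r a : ℕ)), ∑ k : Fin P.d → Fin (2 * R + 1),
      if kvec R k = m then kz a (inOff r a t) o k else 0) +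
  (∑ r : Fin P.d → Fin P.L, ∑ t : Fin (r a : ℕ), ∑ k : Fin P.d → Fin (2 * R + 1),
      if bvec true a + kvec R k = m then kz a (outOff r a t) o k else 0)

/-- Reading a field at displacements `φ k ∈ S` with weights `c k`, regrouped by the displacement. -/
theorem sum_smul_eq_sum_window {W : Type*} [AddCommGroup W] [Module ℂ W] {ι : Type*} [Fintype ι] (S : Finset (Fin P.d → ℤ))
    (φ : ι → (Fin P.d → ℤ)) (hφ : ∀ k, φ k ∈ S) (c : ι → ℝ) (f : (Fin P.d → ℤ) → W) :
    ∑ k, ((c k : ℝ) : ℂ) • f (φ k) = ∑ m ∈ S, ((∑ k, (if φ k = m then c k else 0) : ℝ) : ℂ) • f m := by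
  have hrhs : ∀ m ∈ S, ((∑ k, (if φ k = m then c k else 0) : ℝ) : ℂ) • f m = ∑ k, (if φ k = m then ((c k : ℝ) : ℂ) • f m else 0) := by
    intro m _
    rw [Complex.ofReal_sum, Finset.sum_smul]
    refine Finset.sum_congr rfl fun k _ => ?_
    split_ifs <;> simp
  rw [Finset.sum_congr rfl hrhs, Finset.sum_comm]
  refine Finset.sum_congr rfl fun k _ => ?_
  rw [Finset.sum_ite_eq_of_mem S (φ k) (fun m => ((c k : ℝ) : ℂ) • f m) (hφ k)]

/-- **THE LINE FORM REGROUPED BY DISPLACEMENT**: `lineIn + lineOut = L^{-d} Σ_o Σ_{m ∈ lineWindow} lineCoeff(a, o, m) • w(o, m)`. -/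
theorem lineIn_add_lineOut_eq (a : Fin P.d) (w : Orient P.d → (Fin P.d → ℤ) → Matrix n n ℂ) :
    lineIn (n := n) R kz a w + lineOut (n := n) R kz a w =
      (((P.L : ℂ) ^ P.d))⁻¹ • ∑ o : Orient P.d, ∑ m ∈ lineWindow P.d R, ((lineCoeff R kz a o m : ℝ) : ℂ) • w o m := by
  unfold lineIn lineOut
  rw [← smul_add]
  congr 1
  -- regroup the innermost `k`-sums by displacement
  have hin : ∀ (r : Fin P.d → Fin P.L) (t : Fin (P.L - (r a : ℕ))) (o : Orient P.d),
      ∑ k : Fin P.d → Fin (2 * R + 1), ((kz a (inOff r a t) o k : ℝ) : ℂ) • w o (kvec R k) =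
        ∑ m ∈ lineWindow P.d R, ((∑ k : Fin P.d → Fin (2 * R + 1), (if kvec R k = m then kz a (inOff r a t) o k else 0) : ℝ) : ℂ) • w o m :=
    fun r t o => sum_smul_eq_sum_window _ _ (kvec_mem_lineWindow R) _ (w o)
  have hout : ∀ (r : Fin P.d → Fin P.L) (t : Fin (r a : ℕ)) (o : Orient P.d),
      ∑ k : Fin P.d → Fin (2 * R + 1), ((kz a (outOff r a t) o k : ℝ) : ℂ) • w o (bvec true a + kvec R k) =
        ∑ m ∈ lineWindow P.d R,
          ((∑ k : Fin P.d → Fin (2 * R + 1), (if bvec true a + kvec R k = m then kz a (outOff r a t) o k else 0) : ℝ) : ℂ) • w o m :=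
    fun r t o => sum_smul_eq_sum_window _ _ (bvec_add_kvec_mem_lineWindow R a) _ (w o)
  simp_rw [hin, hout]
  -- bundle `(r, t)` into sigma types and move `(o, m)` outside
  rw [Finset.sum_sigma' (Finset.univ : Finset (Fin P.d → Fin P.L)) (fun r => (Finset.univ : Finset (Fin (P.L - (r a : ℕ)))))
      (fun r t => ∑ o : Orient P.d, ∑ m ∈ lineWindow P.d R,
        ((∑ k : Fin P.d → Fin (2 * R + 1), (if kvec R k = m then kz a (inOff r a t) o k else 0) : ℝ) : ℂ) • w o m),
    Finset.sum_sigma' (Finset.univ : Finset (Fin P.d → Fin P.L)) (fun r => (Finset.univ : Finset (Fin (r a : ℕ))))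
      (fun r t => ∑ o : Orient P.d, ∑ m ∈ lineWindow P.d R,
        ((∑ k : Fin P.d → Fin (2 * R + 1), (if bvec true a + kvec R k = m then kz a (outOff r a t) o k else 0) : ℝ) : ℂ) • w o m)]
  rw [Finset.sum_comm (s := (Finset.univ : Finset (Fin P.d → Fin P.L)).sigma _),
    Finset.sum_comm (s := (Finset.univ : Finset (Fin P.d → Fin P.L)).sigma _), ← Finset.sum_add_distrib]
  refine Finset.sum_congr rfl fun o _ => ?_
  rw [Finset.sum_comm (s := (Finset.univ : Finset (Fin P.d → Fin P.L)).sigma _),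
    Finset.sum_comm (s := (Finset.univ : Finset (Fin P.d → Fin P.L)).sigma _), ← Finset.sum_add_distrib]
  refine Finset.sum_congr rfl fun m _ => ?_
  rw [← Finset.sum_smul, ← Finset.sum_smul, ← add_smul]
  congr 1
  unfold lineCoeff
  push_cast
  rw [Finset.sum_sigma, Finset.sum_sigma]

/-- **LINE-NEUTRALITY FROM THE COEFFICIENTS**: if every line coefficient in the window vanishes, the table is line-neutral. -/
theorem lineNeutral_of_lineCoeff (h : ∀ (a : Fin P.d) (o : Orient P.d), ∀ m ∈ lineWindow P.d R, lineCoeff R kz a o m = 0) :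
    LineNeutral (n := n) R kz := by
  intro a w
  rw [lineIn_add_lineOut_eq]
  rw [Finset.sum_eq_zero fun o _ => Finset.sum_eq_zero fun m hm => by rw [h a o m hm, Complex.ofReal_zero, zero_smul], smul_zero]

end Summit.QuantumFields.YangMills.Theorems.ApproxLift

end
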